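import Mathlib.Combinatorics.SimpleGraph.Metric
import Literature.AnabelianGeometry.SemiGraphs.SubdivisionLemmas
import HarnessLib

/-!
# Folding along a morphism of semi-graphs: a connected set of nodes whose stars all fold onto one edge
# lands in the two ends of that edge ([SemiAnbd] §1, §3 Thm 3.7 (iii) p. 41 — tree combinatorics)

Mochizuki, *Semi-graphs of anabelioids*, Publ. RIMS **42** (2006), §1 pp. 11–13 (semi-graphs, morphisms,
the associated topological space) and §3 Theorem 3.7 (iii), manuscript pp. 40–41
[cite: MochizukiSemiAnbd2006, Thm 3.7(iii) pp.40-41] ("a compatible system of vertices of `𝒢_{∞,j}` … fixed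
by `H`"; "if `H` fixes two vertices of `𝒢_{∞,j}`, then these two vertices are joined to one another by a
single edge").

PROOF-ONLY, PURE COMBINATORICS (cell abc-iut, layer L3, GAP row G-t6g3-2b «no escape», binder `hbdd`
«two compatible `C`-fixed vertex systems of a compact `C ≠ 1` stay at bounded distance»; seat abc-iut-w6-d062,
brick B2 of the desk memo HOME/staging/w6/w6-d062/HBDD-LOCFIN-memo.md (sha16 e85fc6d95ced0a67): `hbdd` holds
with bound `1` at every LOCALLY FINITE countable `𝒢`).  No group, no tree, no tower enters here: for a
morphism `f : T' ⟶ T` of semi-graphs, a set `F` of points of the barycentric subdivision of `T'` (in the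
application: the points fixed by a compact subgroup at a deep level `j'`, `f` the transition map to a
reference level `j`) and an edge `ε` of `T` all of whose abutting vertices lie in `{a, a'}`, suppose the
FOLDING HYPOTHESIS: at every vertex `v` of `T'` whose point lies in `F` and which maps to `a` or to `a'`,
any two branches abutting to `v` whose points lie in `F` have edges with THE SAME image under `f` (in the
application: the estrangement-depth lemma of the memo, §2).  Then along every walk of the subdivision of
`T'` inside `F` that starts at a vertex over `a` or `a'` carrying an `F`-branch whose edge maps to `ε`,
every edge met maps to `ε` and every vertex met maps into `{a, a'}`:

* `SemiGraph.folding_along_walk` — the inductive statement on walks of the subdivision (vertex, edge and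
  branch points);
* `SemiGraph.vertexMap_eq_or_eq_of_folding` — the vertex form consumed by the memo's §3 Step 3: the far
  end `q` of the walk maps to `a` or to `a'`;
* `SemiGraph.exists_ends_dist_le_four` — bookkeeping for the consumer: an edge `ε` with a branch abutting to
  `a` has a second "end" `a'` (the vertex of its other branch, or `a` itself if that branch abuts to no
  vertex) with all abutting vertices of `ε` in `{a, a'}` and `dist (a, a') ≤ 4` in the subdivision of `T` —
  so the conclusion of `vertexMap_eq_or_eq_of_folding` yields the `hbdd` bound `4` in subdivision distance.

Nothing here takes a side on [IUTchIII] Cor. 3.12; nothing here asserts `hbdd` for any `𝒢` (that needs the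
depth lemma, brick B1); typed ≠ proved elsewhere.
-/

namespace Literature.AnabelianGeometry.SemiGraphs

namespace SemiGraph

universe u

variable {T' T : SemiGraph.{u}} (f : T' ⟶ T) (F : Set T'.Node) {a a' : T.Vertex} {ε : T.Edge}

/-- **Folding along a walk of the subdivision.**  Hypotheses: `hends` — every vertex to which a branch
of `ε` abuts is `a` or `a'`; `hsame` — at a vertex `v` with point in `F` mapping to `a` or `a'`, two
`F`-branches abutting to `v` have edges with equal `f`-image.  Conclusion, for a walk `p` of the
subdivision of `T'` with support in `F`: if its origin satisfies the invariant «vertex ↦ `a` or `a'`;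
edge ↦ `ε`; branch ↦ its edge maps to `ε`» together with the side condition «an origin VERTEX carries an
`F`-branch whose edge maps to `ε`», then so does its end.  Induction on the walk: vertex → branch uses
`hsame` against the branch by which the walk arrived (or the given one at the origin), branch → vertex
uses `hends` through `f.abuts_branchMap`, edge ↔ branch is `f.edgeOf_branchMap`.
[cite: MochizukiSemiAnbd2006, Thm 3.7(iii) p.41] -/
theorem folding_along_walk
    (hends : ∀ (c : T.Branch) (w : T.Vertex), T.edgeOf c = ε → T.abuts c = some w → w = a ∨ w = a')
    (hsame : ∀ v : T'.Vertex, Sum.inl v ∈ F → (f.vertexMap v = a ∨ f.vertexMap v = a') →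
      ∀ β β' : T'.Branch, (Sum.inr (Sum.inr β) : T'.Node) ∈ F → (Sum.inr (Sum.inr β') : T'.Node) ∈ F →
        T'.abuts β = some v → T'.abuts β' = some v → f.edgeMap (T'.edgeOf β) = f.edgeMap (T'.edgeOf β'))
    {ν ω : T'.Node} (p : T'.subdivision.Walk ν ω) (hp : ∀ x ∈ p.support, x ∈ F)
    (hν : (∀ v, ν = Sum.inl v → f.vertexMap v = a ∨ f.vertexMap v = a') ∧
      (∀ η, ν = Sum.inr (Sum.inl η) → f.edgeMap η = ε) ∧
      (∀ β, ν = Sum.inr (Sum.inr β) → f.edgeMap (T'.edgeOf β) = ε))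
    (hside : ∀ v, ν = Sum.inl v → ∃ β : T'.Branch, (Sum.inr (Sum.inr β) : T'.Node) ∈ F ∧
      T'.abuts β = some v ∧ f.edgeMap (T'.edgeOf β) = ε) :
    ((∀ v, ω = Sum.inl v → f.vertexMap v = a ∨ f.vertexMap v = a') ∧
      (∀ η, ω = Sum.inr (Sum.inl η) → f.edgeMap η = ε) ∧
      (∀ β, ω = Sum.inr (Sum.inr β) → f.edgeMap (T'.edgeOf β) = ε)) ∧
    (∀ v, ω = Sum.inl v → ∃ β : T'.Branch, (Sum.inr (Sum.inr β) : T'.Node) ∈ F ∧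
      T'.abuts β = some v ∧ f.edgeMap (T'.edgeOf β) = ε) := by
  induction p with
  | nil => exact ⟨hν, hside⟩
  | @cons x y z hadj p ih =>
    have hxF : x ∈ F := hp x (SimpleGraph.Walk.start_mem_support _)
    have hp' : ∀ w ∈ p.support, w ∈ F := fun w hw =>
      hp w (by rw [SimpleGraph.Walk.support_cons]; exact List.mem_cons_of_mem _ hw)
    have hyF : y ∈ F := hp' y (SimpleGraph.Walk.start_mem_support _)
    apply ih hp'
    -- the invariant at `y`, by cases on `x`
    · rcases x with v | η | β
      · -- `x` a vertex: `y` is a branch abutting to `v`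
        obtain ⟨β', hβ'v, rfl⟩ := (T'.subdivision_adj_inl_iff v y).1 hadj
        obtain ⟨β, hβF, hβv, hβε⟩ := hside v rfl
        have hv : f.vertexMap v = a ∨ f.vertexMap v = a' := hν.1 v rfl
        refine ⟨fun w hw => (by cases hw), fun η hη => (by cases hη), fun β'' hβ'' => ?_⟩
        have hbb : β' = β'' := Sum.inr.inj (Sum.inr.inj hβ'')
        subst hbb
        rw [← hsame v hxF hv β β' hβF hyF hβv hβ'v]
        exact hβε
      · -- `x` an edge: `y` is one of its branches
        obtain ⟨β', hβ'η, rfl⟩ := (T'.subdivision_adj_edge_iff η y).1 hadj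
        refine ⟨fun w hw => (by cases hw), fun η' hη' => (by cases hη'), fun β'' hβ'' => ?_⟩
        have hbb : β' = β'' := Sum.inr.inj (Sum.inr.inj hβ'')
        subst hbb
        rw [hβ'η]
        exact hν.2.1 η rfl
      · -- `x` a branch: `y` is its edge or the vertex it abuts to
        have hβε : f.edgeMap (T'.edgeOf β) = ε := hν.2.2 β rfl
        rcases (T'.subdivision_adj_branch_iff β y).1 hadj with rfl | ⟨v, hβv, rfl⟩
        · refine ⟨fun w hw => (by cases hw), fun η' hη' => ?_, fun β'' hβ'' => (by cases hβ'')⟩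
          have hηη : T'.edgeOf β = η' := Sum.inl.inj (Sum.inr.inj hη')
          rw [← hηη]
          exact hβε
        · refine ⟨fun w hw => ?_, fun η' hη' => (by cases hη'), fun β'' hβ'' => (by cases hβ'')⟩
          have hww : v = w := Sum.inl.inj hw
          subst hww
          have h1 : T.edgeOf (f.branchMap β) = ε := by rw [f.edgeOf_branchMap, hβε]
          exact hends (f.branchMap β) (f.vertexMap v) h1 (f.abuts_branchMap β v hβv)
    -- the side condition at `y`
    · rcases x with v | η | β
      · obtain ⟨β', -, rfl⟩ := (T'.subdivision_adj_inl_iff v y).1 hadj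
        intro w hw; cases hw
      · obtain ⟨β', -, rfl⟩ := (T'.subdivision_adj_edge_iff η y).1 hadj
        intro w hw; cases hw
      · have hβε : f.edgeMap (T'.edgeOf β) = ε := hν.2.2 β rfl
        rcases (T'.subdivision_adj_branch_iff β y).1 hadj with rfl | ⟨v, hβv, rfl⟩
        · intro w hw; cases hw
        · intro w hw
          have hww : v = w := Sum.inl.inj hw
          subst hww
          exact ⟨β, hxF, hβv, hβε⟩

/-- **The vertex form**: under the folding hypotheses, for a walk of the subdivision of `T'` with support
in `F` from the point of a vertex `x₀` (mapping to `a` or `a'`, carrying an `F`-branch `β₀` whose edge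
maps to `ε`) to the point of a vertex `q`, the vertex `q` maps to `a` or to `a'`.  (In the memo's §3:
`x₀ = x_{j'}`, `F` = the points fixed by `C` at level `j'`, `f` = the transition map to level `j`,
`ε = ε*`, `{a, a'} = {x_j, r*}`, `q = x'_{j'}`; hence `x'_j ∈ {x_j, r*}`.)
[cite: MochizukiSemiAnbd2006, Thm 3.7(iii) p.41] -/
theorem vertexMap_eq_or_eq_of_folding
    (hends : ∀ (c : T.Branch) (w : T.Vertex), T.edgeOf c = ε → T.abuts c = some w → w = a ∨ w = a')
    (hsame : ∀ v : T'.Vertex, Sum.inl v ∈ F → (f.vertexMap v = a ∨ f.vertexMap v = a') →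
      ∀ β β' : T'.Branch, (Sum.inr (Sum.inr β) : T'.Node) ∈ F → (Sum.inr (Sum.inr β') : T'.Node) ∈ F →
        T'.abuts β = some v → T'.abuts β' = some v → f.edgeMap (T'.edgeOf β) = f.edgeMap (T'.edgeOf β'))
    {x₀ q : T'.Vertex} (p : T'.subdivision.Walk (Sum.inl x₀) (Sum.inl q)) (hp : ∀ x ∈ p.support, x ∈ F)
    (hx₀ : f.vertexMap x₀ = a ∨ f.vertexMap x₀ = a')
    (β₀ : T'.Branch) (hβ₀F : (Sum.inr (Sum.inr β₀) : T'.Node) ∈ F) (hβ₀ : T'.abuts β₀ = some x₀)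
    (hfβ₀ : f.edgeMap (T'.edgeOf β₀) = ε) :
    f.vertexMap q = a ∨ f.vertexMap q = a' := by
  have h := folding_along_walk f F hends hsame p hp
    ⟨fun v hv => (Sum.inl.inj hv) ▸ hx₀, fun η hη => (by cases hη), fun β hβ => (by cases hβ)⟩
    (fun v hv => ⟨β₀, hβ₀F, (Sum.inl.inj hv) ▸ hβ₀, hfβ₀⟩)
  exact h.1.1 q rfl

/-- **The two ends of an edge, with their subdivision distance.**  For an edge `ε` of `T` with a branch
`c₀` abutting to `a` there is a vertex `a'` — the vertex of the other branch of `ε`, or `a` itself when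
that branch abuts to no vertex — such that every vertex to which a branch of `ε` abuts is `a` or `a'`,
and `dist (a, a') ≤ 4` in the barycentric subdivision (`a – c₀ – ε – c – a'`).  (Consumer: with
`vertexMap_eq_or_eq_of_folding` this turns complete folding at a reference level into the bound
`dist (x_j, x'_j) ≤ 4` of the binder `hbdd`.) [cite: MochizukiSemiAnbd2006, §1 pp.11-12] -/
theorem exists_ends_dist_le_four {T : SemiGraph.{u}} (ε : T.Edge) {a : T.Vertex} (c₀ : T.Branch)
    (hc₀ε : T.edgeOf c₀ = ε) (hc₀a : T.abuts c₀ = some a) :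
    ∃ a' : T.Vertex,
      (∀ (c : T.Branch) (w : T.Vertex), T.edgeOf c = ε → T.abuts c = some w → w = a ∨ w = a') ∧
      T.subdivision.dist (Sum.inl a) (Sum.inl a') ≤ 4 := by
  obtain ⟨b₁, b₂, hne, hb₁, hb₂, hall⟩ := T.two_branches ε
  -- the branch `c` of `ε` other than `c₀`
  obtain ⟨c, hcε, hcall⟩ : ∃ c : T.Branch, T.edgeOf c = ε ∧
      ∀ d : T.Branch, T.edgeOf d = ε → d = c₀ ∨ d = c := by
    rcases hall c₀ hc₀ε with h | h
    · exact ⟨b₂, hb₂, fun d hd => by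
        rcases hall d hd with h' | h'
        · exact Or.inl (h'.trans h.symm)
        · exact Or.inr h'⟩
    · exact ⟨b₁, hb₁, fun d hd => by
        rcases hall d hd with h' | h'
        · exact Or.inr h'
        · exact Or.inl (h'.trans h.symm)⟩
  -- adjacency facts of the subdivision
  have hA1 : T.subdivision.Adj (Sum.inl a) (Sum.inr (Sum.inr c₀)) :=
    (T.subdivision_adj_inl_iff a _).2 ⟨c₀, hc₀a, rfl⟩
  have hA2 : T.subdivision.Adj (Sum.inr (Sum.inr c₀)) (Sum.inr (Sum.inl ε)) :=
    (T.subdivision_adj_branch_iff c₀ _).2 (Or.inl (by rw [hc₀ε]))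
  have hA3 : T.subdivision.Adj (Sum.inr (Sum.inl ε)) (Sum.inr (Sum.inr c)) :=
    (T.subdivision_adj_edge_iff ε _).2 ⟨c, hcε, rfl⟩
  cases hca : T.abuts c with
  | none =>
    refine ⟨a, fun d w hd hw => ?_, by simp⟩
    rcases hcall d hd with rfl | rfl
    · exact Or.inl (Option.some.inj (hw.symm.trans hc₀a))
    · rw [hca] at hw; cases hw
  | some a' =>
    refine ⟨a', fun d w hd hw => ?_, ?_⟩
    · rcases hcall d hd with rfl | rfl
      · exact Or.inl (Option.some.inj (hw.symm.trans hc₀a))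
      · exact Or.inr (Option.some.inj (hw.symm.trans hca))
    · have hA4 : T.subdivision.Adj (Sum.inr (Sum.inr c)) (Sum.inl a') :=
        (T.subdivision_adj_branch_iff c _).2 (Or.inr ⟨a', hca, rfl⟩)
      let w : T.subdivision.Walk (Sum.inl a) (Sum.inl a') :=
        SimpleGraph.Walk.cons hA1 (SimpleGraph.Walk.cons hA2
          (SimpleGraph.Walk.cons hA3 (SimpleGraph.Walk.cons hA4 SimpleGraph.Walk.nil)))
      have hw : w.length = 4 := rfl
      exact hw ▸ SimpleGraph.dist_le w

end SemiGraph

end Literature.AnabelianGeometry.SemiGraphs
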